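import Summits.QuantumFields.BalabanUV.T4Continuum.Support.NE3FlatWeightedCoerciveEnd
import HarnessLib

/-!
# T⁴ programme, node NE3 — (ML_w) AT THE FLAT BACKGROUND: THE LANDAU-AWARE SOCKETS (matrix and ℂ-entry currencies) for an
# N-FREE block-Poincaré constant on `ker d(avg^k)(1) ∩ {flatDiv = 0}`

NE3 formalisation swarm, LEAF PROVER 02 (unit `b2b-balaban-t4-ne3-formalise-leaf-02`, gen 4; cell `pub-balaban`); row E-MLw-w2
(this unit's `NE3FlatWeightedCoercive` p219617 ∕ `NE3FlatWeightedCoerciveEnd` p220006).  WHY: the landed socket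
`weightedTangentCoercive_flatTangentLandau_of_blockPoincare` feeds its block-Poincaré hypothesis `hP` only periodicity and tangency —
enough for row E-MLw-w3's `5 + 2dN²` (leaf-04, `NE3BlockPoincareTangent`), but the owner's N-FREE constant (design D-ne3p1-g21-1 §1
(VI)–(VII), row F2 `NE3BlockPoincareLandau`: `Σ‖Y‖² ≤ 9·(L^k)²·Σ‖∂Y‖²` on `ker (Tcoarse L)^[k] ∩ {flatDiv = 0}`) USES the Landau
condition.  THIS FILE (0 `def`, 0 sorry, [folklore]) adds the sockets that pass skewness AND the Landau condition to `hP`: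
* §1 matrix (`nhsNormSq`) currency: **`weightedTangentCoercive_flatTangentLandau_of_blockPoincareLandau`**,
  `weightedPoincare_flatTangentLandau_of_blockPoincareLandau`;
* §2 the ℂ-ENTRY reduction `sum_nhsNormSq_le_of_entrywise` (a matrix direction is tangent ∕ Landau iff every entry cochain is:
  `NE3TangentFlatStructure.iterate_Tcoarse_eq_zero_of_tangentIter` ∕ `iterate_Tcoarse_entry_eq_zero`, `Matrix.sum_apply`), and the
  ℂ-currency sockets **`weightedTangentCoercive_flatTangentLandau_of_entrywise`** ∕ `weightedPoincare_flatTangentLandau_of_entrywise`: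
  from `hPc : ∀ j (y : Site d → Fin d → ℂ), (L^{j+1}·N)-periodic → (Tcoarse L)^[j+1] y = 0 → (∀ x, Σ_μ (y x μ − y (x − e_μ) μ) = 0) →
  Σ‖y‖² ≤ C_P·(L^{j+1})²·Σ‖∂y‖²` (the shape of `NE3BlockPoincareCore.sum_norm_sq_le_of_iterate_Tcoarse_eq_zero` plus the Landau
  binder) to `WeightedTangentCoercive L k 1 (flatTangentLandau L N k) (1∕(card n·(1 + C_P))) (periodBox (N·L^k))` and (P_1) with
  `card n·C_P` — so an N-free `C_P = 9` gives (ML_w) at `W = 1` with the N-FREE constant `1∕(10·card n)`.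
HONEST FRAMING.  Sockets only (linear algebra over landed theorems); the N-free constant itself is NOT proved here; (ML_w) off the
flat background, T-E_w, NE3 NOT proved; spine PROVED 0∕9; finite T⁴ rung (B)+1 — NOT infinite volume, NOT mass gap, NOT `BetaPertH`,
NOT Clay.  Context: [Balaban1985Variational] (26)–(27) p.282; [Balaban1985PropagatorsII] §3.  PLACEMENT: `Summits/QuantumFields/BalabanUV/`.
HONEST DEPENDENCY: continuum YM on T⁴ ⇐ BetaPertH ∧ nine spine estimates (0/9 proved); BetaPertH ⇐ (D1) ∧ (D4) ∧ CAP+tail;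
G-an2-4 gates asym, D1 and NE2/3/4.
-/

set_option autoImplicit false

open scoped BigOperators Matrix Matrix.Norms.L2Operator
open Finset

namespace Summit.QuantumFields.BalabanUV.T4Continuum.NE3FlatWeightedCoerciveLandau

open Literature.MathematicalPhysics.QuantumFieldTheory.Balaban1983to89
open B7Prop1Explicit (Site e)
open T4AveragingDeficitWall (curlSq dirSq IsSkewDir)
open T4AveragingDeficitWallBoundary (periodBox)
open AveragingDeficitPeriodicCounting (IsPeriodicDir)
open AveragingDeficitMultiLevelPrep (TangentIter)
open BlockAveragePushDirSplit (flat)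
open SmoothRefineNeutral (Tcoarse)
open MinimalActionWitness (flatCfg)
open MatrixNorms (nhsNormSq)
open NE3EnergyWeightedShapes (WeightedTangentCoercive)
open NE3CoercivityScaling (flatDiv flatTangentLandau)
open NE3TangentFlatStructure (iterate_Tcoarse_eq_zero_of_tangentIter iterate_Tcoarse_entry_eq_zero)
open NE3LatticeWeitzenbock (dirSq_le_card_mul)
open NE3FlatWeightedCoercive (weightedTangentCoercive_flatTangentLandau_of_poincare weightedPoincare_flatCfg_of_dirSq_le)
open NE3BlockPoincareTangent (sum_entries_eq_card_mul_nhs sum_entries_grad_eq_card_mul_nhs)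

noncomputable section

variable {d : ℕ} {n : Type*} [Fintype n] [DecidableEq n]

/-! ## §1 Matrix currency: the block-Poincaré hypothesis receives skewness and the Landau condition -/

/-- **(ML_w) AT `W = 1` FROM A BLOCK-POINCARÉ CONSTANT ON THE TANGENT-LANDAU SPACE** (matrix ∕ `nhsNormSq` currency): if for every
`j` and every skew `(N·L^{j+1})`-periodic `Y` with `TangentIter L j 1 Y` AND `flatDiv Y ≡ 0`,
`Σ_x Σ_κ nhsNormSq (Y x κ) ≤ C_P·(L^{j+1})²·Σ_x Σ_κ Σ_μ nhsNormSq (Y(x+e_μ) κ − Y x κ)`, then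
`WeightedTangentCoercive L k 1 (flatTangentLandau L N k) (1∕(card n·(1 + C_P))) [0, N·L^k)^d` (`k, L, N ≥ 1`). [folklore] -/
theorem weightedTangentCoercive_flatTangentLandau_of_blockPoincareLandau [Nonempty n] {L N : ℕ} (hL : 1 ≤ L) (hN : 1 ≤ N)
    {k : ℕ} (hk : 1 ≤ k) {CP : ℝ} (hCP : 0 ≤ CP)
    (hP : ∀ (j : ℕ) (Y : Site d → Fin d → Matrix n n ℂ), IsSkewDir Y → IsPeriodicDir Y ((N * L ^ (j + 1) : ℕ) : ℤ) →
      TangentIter L j (flat (d := d) (n := n)) Y → (∀ x : Site d, flatDiv Y x = 0) →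
        ∑ x ∈ periodBox (N * L ^ (j + 1)), ∑ κ : Fin d, nhsNormSq (Y x κ)
          ≤ CP * ((L : ℝ) ^ (j + 1)) ^ 2 *
            ∑ x ∈ periodBox (N * L ^ (j + 1)), ∑ κ : Fin d, ∑ μ : Fin d, nhsNormSq (Y (x + e μ) κ - Y x κ)) :
    WeightedTangentCoercive L k (flatCfg (d := d) (n := n)) (flatTangentLandau L N k) (1 / (Fintype.card n * (1 + CP)))
      (periodBox (N * L ^ k)) := by
  obtain ⟨j, rfl⟩ : ∃ j, k = j + 1 := ⟨k - 1, by omega⟩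
  have hNL : 1 ≤ N * L ^ (j + 1) := Nat.mul_pos (by omega) (Nat.pow_pos (by omega))
  refine weightedTangentCoercive_flatTangentLandau_of_poincare hNL hCP fun Y hY => ?_
  have htan : TangentIter L j (flat (d := d) (n := n)) Y := by
    have h1 : TangentIter L (j + 1 - 1) (flatCfg (d := d) (n := n)) Y := hY.2.2.1
    rw [Nat.add_sub_cancel] at h1
    exact h1
  have h := hP j Y hY.1 hY.2.1 htan hY.2.2.2
  have hS : ∑ x ∈ periodBox (N * L ^ (j + 1)), ∑ κ : Fin d, ∑ μ : Fin d, nhsNormSq (Y (x + e μ) κ - Y x κ)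
      = ∑ x ∈ periodBox (N * L ^ (j + 1)), ∑ μ : Fin d, ∑ ν : Fin d, nhsNormSq (Y (x + e μ) ν - Y x ν) :=
    Finset.sum_congr rfl fun _ _ => Finset.sum_comm
  rw [hS, mul_assoc] at h
  exact h

/-- **(P_1) ON `flatTangentLandau L N k`** from the same Landau-aware block-Poincaré hypothesis:
`∀ Y ∈ flatTangentLandau L N k, (L^k)⁻²·dirSq Y F ≤ (card n·C_P)·curlSq 1 Y F`, `F = [0, N·L^k)^d`. [folklore] -/
theorem weightedPoincare_flatTangentLandau_of_blockPoincareLandau [Nonempty n] {L N : ℕ} (hL : 1 ≤ L) (hN : 1 ≤ N)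
    {k : ℕ} (hk : 1 ≤ k) {CP : ℝ} (hCP : 0 ≤ CP)
    (hP : ∀ (j : ℕ) (Y : Site d → Fin d → Matrix n n ℂ), IsSkewDir Y → IsPeriodicDir Y ((N * L ^ (j + 1) : ℕ) : ℤ) →
      TangentIter L j (flat (d := d) (n := n)) Y → (∀ x : Site d, flatDiv Y x = 0) →
        ∑ x ∈ periodBox (N * L ^ (j + 1)), ∑ κ : Fin d, nhsNormSq (Y x κ)
          ≤ CP * ((L : ℝ) ^ (j + 1)) ^ 2 *
            ∑ x ∈ periodBox (N * L ^ (j + 1)), ∑ κ : Fin d, ∑ μ : Fin d, nhsNormSq (Y (x + e μ) κ - Y x κ)) :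
    ∀ Y ∈ flatTangentLandau (d := d) (n := n) L N k, (((L : ℝ) ^ k)⁻¹) ^ 2 * dirSq Y (periodBox (N * L ^ k))
      ≤ (Fintype.card n * CP) * curlSq (flatCfg (d := d) (n := n)) Y (periodBox (N * L ^ k)) := by
  obtain ⟨j, rfl⟩ : ∃ j, k = j + 1 := ⟨k - 1, by omega⟩
  have hNL : 1 ≤ N * L ^ (j + 1) := Nat.mul_pos (by omega) (Nat.pow_pos (by omega))
  have hK : 0 ≤ (Fintype.card n : ℝ) * CP := by positivity
  refine weightedPoincare_flatCfg_of_dirSq_le hNL hK (fun _ hY => hY.2.1) (fun _ hY => hY.2.2.2) fun Y hY => ?_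
  have htan : TangentIter L j (flat (d := d) (n := n)) Y := by
    have h1 : TangentIter L (j + 1 - 1) (flatCfg (d := d) (n := n)) Y := hY.2.2.1
    rw [Nat.add_sub_cancel] at h1
    exact h1
  have h := hP j Y hY.1 hY.2.1 htan hY.2.2.2
  have hS : ∑ x ∈ periodBox (N * L ^ (j + 1)), ∑ κ : Fin d, ∑ μ : Fin d, nhsNormSq (Y (x + e μ) κ - Y x κ)
      = ∑ x ∈ periodBox (N * L ^ (j + 1)), ∑ μ : Fin d, ∑ ν : Fin d, nhsNormSq (Y (x + e μ) ν - Y x ν) :=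
    Finset.sum_congr rfl fun _ _ => Finset.sum_comm
  rw [hS, mul_assoc] at h
  calc dirSq Y (periodBox (N * L ^ (j + 1)))
      ≤ Fintype.card n * ∑ x ∈ periodBox (N * L ^ (j + 1)), ∑ κ : Fin d, nhsNormSq (Y x κ) := dirSq_le_card_mul Y _
    _ ≤ Fintype.card n * (CP * (((L : ℝ) ^ (j + 1)) ^ 2 *
        ∑ x ∈ periodBox (N * L ^ (j + 1)), ∑ μ : Fin d, ∑ ν : Fin d, nhsNormSq (Y (x + e μ) ν - Y x ν))) :=
      mul_le_mul_of_nonneg_left h (Nat.cast_nonneg _)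
    _ = Fintype.card n * CP * (((L : ℝ) ^ (j + 1)) ^ 2 *
        ∑ x ∈ periodBox (N * L ^ (j + 1)), ∑ μ : Fin d, ∑ ν : Fin d, nhsNormSq (Y (x + e μ) ν - Y x ν)) := by ring

/-! ## §2 The ℂ-entry currency: a matrix direction is tangent and Landau iff every entry cochain is -/

/-- **ENTRYWISE REDUCTION WITH THE LANDAU CONDITION.**  If every `(L^{j+1}·N)`-periodic complex cochain `y` with `(Tcoarse L)^[j+1] y = 0`
and `Σ_μ (y x μ − y (x − e_μ) μ) = 0` for all `x` satisfies `Σ‖y‖² ≤ C_P·(L^{j+1})²·Σ‖∂y‖²` on the torus, then every `(N·L^{j+1})`-periodic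
matrix direction `Y` with `TangentIter L j 1 Y` and `flatDiv Y ≡ 0` satisfies the same in the `nhsNormSq` currency (sum over the `n²`
entries, `NE3BlockPoincareTangent.sum_entries_eq_card_mul_nhs`). [folklore] -/
theorem sum_nhsNormSq_le_of_entrywise [Nonempty n] {L : ℕ} (hL : 1 ≤ L) {N : ℕ} {j : ℕ} {CP : ℝ}
    (hPc : ∀ y : Site d → Fin d → ℂ, (∀ (x : Site d) (τ μ : Fin d), y (x + ((L ^ (j + 1) * N : ℕ) : ℤ) • e τ) μ = y x μ) →
      (Tcoarse L)^[j + 1] y = 0 → (∀ x : Site d, ∑ μ : Fin d, (y x μ - y (x - e μ) μ) = 0) →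
        ∑ x ∈ periodBox (d := d) (L ^ (j + 1) * N), ∑ κ : Fin d, ‖y x κ‖ ^ 2
          ≤ CP * ((L : ℝ) ^ (j + 1)) ^ 2 *
            ∑ x ∈ periodBox (d := d) (L ^ (j + 1) * N), ∑ κ : Fin d, ∑ μ : Fin d, ‖y (x + e μ) κ - y x κ‖ ^ 2)
    {Y : Site d → Fin d → Matrix n n ℂ} (hYper : IsPeriodicDir Y ((N * L ^ (j + 1) : ℕ) : ℤ))
    (hY : TangentIter L j (flat (d := d) (n := n)) Y) (hdiv : ∀ x : Site d, flatDiv Y x = 0) :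
    ∑ x ∈ periodBox (d := d) (N * L ^ (j + 1)), ∑ κ : Fin d, nhsNormSq (Y x κ)
      ≤ CP * ((L : ℝ) ^ (j + 1)) ^ 2
          * ∑ x ∈ periodBox (d := d) (N * L ^ (j + 1)), ∑ κ : Fin d, ∑ μ : Fin d, nhsNormSq (Y (x + e μ) κ - Y x κ) := by
  have hT : (Tcoarse L)^[j + 1] Y = 0 := iterate_Tcoarse_eq_zero_of_tangentIter hL j Y hY
  rw [show N * L ^ (j + 1) = L ^ (j + 1) * N from Nat.mul_comm _ _]
  set F := periodBox (d := d) (L ^ (j + 1) * N) with hF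
  have hent : ∀ pq : n × n, ∑ x ∈ F, ∑ κ : Fin d, ‖Y x κ pq.1 pq.2‖ ^ 2
      ≤ CP * ((L : ℝ) ^ (j + 1)) ^ 2 * ∑ x ∈ F, ∑ κ : Fin d, ∑ μ : Fin d, ‖Y (x + e μ) κ pq.1 pq.2 - Y x κ pq.1 pq.2‖ ^ 2 := by
    intro pq
    have hper : ∀ (x : Site d) (τ μ : Fin d),
        (fun y ν => Y y ν pq.1 pq.2) (x + ((L ^ (j + 1) * N : ℕ) : ℤ) • e τ) μ = (fun y ν => Y y ν pq.1 pq.2) x μ := by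
      intro x τ μ
      simp only
      rw [show (L ^ (j + 1) * N : ℕ) = N * L ^ (j + 1) from Nat.mul_comm _ _, hYper x τ μ]
    have hdiv' : ∀ x : Site d, ∑ μ : Fin d, ((fun y ν => Y y ν pq.1 pq.2) x μ - (fun y ν => Y y ν pq.1 pq.2) (x - e μ) μ) = 0 := by
      intro x
      have h := congrArg (fun A : Matrix n n ℂ => A pq.1 pq.2) (hdiv x)
      simpa only [NE3CoercivityScaling.flatDiv, Matrix.sum_apply, Matrix.sub_apply, Matrix.zero_apply] using h
    exact hPc _ hper (iterate_Tcoarse_entry_eq_zero L hT pq.1 pq.2) hdiv'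
  have hsum := Finset.sum_le_sum fun pq (_ : pq ∈ (Finset.univ : Finset (n × n))) => hent pq
  rw [← Finset.mul_sum, sum_entries_eq_card_mul_nhs, sum_entries_grad_eq_card_mul_nhs] at hsum
  have hn : (0 : ℝ) < Fintype.card n := by exact_mod_cast Fintype.card_pos
  rw [mul_left_comm] at hsum
  exact le_of_mul_le_mul_left hsum hn

/-- **(ML_w) AT `W = 1` FROM A ℂ-VALUED BLOCK-POINCARÉ CONSTANT ON `ker (Tcoarse L)^[k] ∩ {flatDiv = 0}`.**  If for every `j` every
`(L^{j+1}·N)`-periodic complex cochain `y` with `(Tcoarse L)^[j+1] y = 0` and vanishing lattice divergence satisfies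
`Σ‖y‖² ≤ C_P·(L^{j+1})²·Σ‖∂y‖²` on the torus (`C_P ≥ 0`; e.g. the N-free `C_P = 9` of the owner's row F2), then
`WeightedTangentCoercive L k 1 (flatTangentLandau L N k) (1∕(card n·(1 + C_P))) [0, N·L^k)^d` (`k, L, N ≥ 1`). [folklore] -/
theorem weightedTangentCoercive_flatTangentLandau_of_entrywise [Nonempty n] {L N : ℕ} (hL : 1 ≤ L) (hN : 1 ≤ N) {k : ℕ}
    (hk : 1 ≤ k) {CP : ℝ} (hCP : 0 ≤ CP)
    (hPc : ∀ (j : ℕ) (y : Site d → Fin d → ℂ),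
      (∀ (x : Site d) (τ μ : Fin d), y (x + ((L ^ (j + 1) * N : ℕ) : ℤ) • e τ) μ = y x μ) →
        (Tcoarse L)^[j + 1] y = 0 → (∀ x : Site d, ∑ μ : Fin d, (y x μ - y (x - e μ) μ) = 0) →
          ∑ x ∈ periodBox (d := d) (L ^ (j + 1) * N), ∑ κ : Fin d, ‖y x κ‖ ^ 2
            ≤ CP * ((L : ℝ) ^ (j + 1)) ^ 2 *
              ∑ x ∈ periodBox (d := d) (L ^ (j + 1) * N), ∑ κ : Fin d, ∑ μ : Fin d, ‖y (x + e μ) κ - y x κ‖ ^ 2) :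
    WeightedTangentCoercive L k (flatCfg (d := d) (n := n)) (flatTangentLandau L N k) (1 / (Fintype.card n * (1 + CP)))
      (periodBox (N * L ^ k)) :=
  weightedTangentCoercive_flatTangentLandau_of_blockPoincareLandau hL hN hk hCP fun j _ _ hper htan hdiv =>
    sum_nhsNormSq_le_of_entrywise hL (hPc j) hper htan hdiv

/-- **(P_1) ON `flatTangentLandau L N k`** from the same ℂ-valued hypothesis: `(L^k)⁻²·dirSq Y F ≤ (card n·C_P)·curlSq 1 Y F`. [folklore] -/
theorem weightedPoincare_flatTangentLandau_of_entrywise [Nonempty n] {L N : ℕ} (hL : 1 ≤ L) (hN : 1 ≤ N) {k : ℕ}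
    (hk : 1 ≤ k) {CP : ℝ} (hCP : 0 ≤ CP)
    (hPc : ∀ (j : ℕ) (y : Site d → Fin d → ℂ),
      (∀ (x : Site d) (τ μ : Fin d), y (x + ((L ^ (j + 1) * N : ℕ) : ℤ) • e τ) μ = y x μ) →
        (Tcoarse L)^[j + 1] y = 0 → (∀ x : Site d, ∑ μ : Fin d, (y x μ - y (x - e μ) μ) = 0) →
          ∑ x ∈ periodBox (d := d) (L ^ (j + 1) * N), ∑ κ : Fin d, ‖y x κ‖ ^ 2
            ≤ CP * ((L : ℝ) ^ (j + 1)) ^ 2 *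
              ∑ x ∈ periodBox (d := d) (L ^ (j + 1) * N), ∑ κ : Fin d, ∑ μ : Fin d, ‖y (x + e μ) κ - y x κ‖ ^ 2) :
    ∀ Y ∈ flatTangentLandau (d := d) (n := n) L N k, (((L : ℝ) ^ k)⁻¹) ^ 2 * dirSq Y (periodBox (N * L ^ k))
      ≤ (Fintype.card n * CP) * curlSq (flatCfg (d := d) (n := n)) Y (periodBox (N * L ^ k)) :=
  weightedPoincare_flatTangentLandau_of_blockPoincareLandau hL hN hk hCP fun j _ _ hper htan hdiv =>
    sum_nhsNormSq_le_of_entrywise hL (hPc j) hper htan hdiv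

end

end Summit.QuantumFields.BalabanUV.T4Continuum.NE3FlatWeightedCoerciveLandau
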